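import Literature.RepresentationTheory.KonnoKonno2007.JunctionVacuumSection
import HarnessLib

/-!
# `KAK` implementer data from a Levi family in a unitary frame

A GENERIC constructor of `KAKImplementerData` (`Literature.NumberTheory.Weil1964.ArchVacuumSection`) — the input to the
canonical vacuum-normalised implementer section and hence to the theta majorants of
`Weil1964.ArchSectionThetaMajorants` — for a topological monoid `G` acting on phase space `ℝ^σ × ℝ^σ` through a
multiplicative family `γ : G → PhaseMap σ`, from:

* a compact part `κ : K → G` implemented by `μ₀ ∘ ιK` for a continuous `ιK : K → U(σ)` with `γ (κ k) = realify (ιK k)`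
  (binder-2's compact Weil representation `unitaryOpPi`, [Folland1989, Prop. (4.39)]);
* an `A`-part `a : P → G` implemented by the **Levi family in a unitary frame**
  `t ↦ μ₀(U)⁻¹ ∘ L(a_t) ∘ μ₀(U)`, where `L(a) f (x) = |det a|^{-1/2} f (a⁻¹ x)` is the Levi dilation `leviS a` of
  [Folland1989, (4.24)] for a continuous family of dilations `t ↦ a_t ∈ GL(ℝ^σ)` with contragredients `d_t`
  (`a_t x · d_t y = x · y`), and `U ∈ U(σ)` is a fixed unitary frame; the hypothesis is the finite-dimensional identity
  `γ (a t) = realify U⁻¹ ∘ m(a_t, d_t) ∘ realify U` on phase space;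
* properness and surjectivity of the word map `(k₁, t, k₂) ↦ κ k₁ · a t · κ k₂` (the `KAK` decomposition,
  [Knapp2002, Thm 7.39]).

The junction data of ONE real unitary dual pair of real rank one (`JunctionVacuumSection.kakImplementerData_junction`,
`hypOp = μ₀(U)⁻¹ ∘ leviS (δ_{e^t}) ∘ μ₀(U)`) is the special case `P = ℝ`; the point of the general form is that a
PRODUCT of such pairs over several real places, or a pair of real rank one in BOTH factors, is again of this shape
with ONE block-diagonal frame `U` and ONE multi-parameter family of commuting plane dilations — no tensor products of
Schwartz operators are needed, only finite-dimensional frame identities and the topology of the word map.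

Also recorded: the degenerate case of a COMPACT `G` (`P = PUnit`, `A`-part trivial).

All statements are kernel-proved; no cited statement enters as a hypothesis.

References: G. B. Folland, Harmonic Analysis in Phase Space, Princeton UP 1989, §1.7 (1.72), §4.2 (4.23)–(4.24)
p. 156, Prop. (4.39); A. W. Knapp, Lie Groups Beyond an Introduction, 2nd ed., Birkhäuser 2002, Thm 7.39;
K. Konno, T. Konno, 2007, §3.1 (the rank-one dual pairs this serves).
-/

noncomputable section

open MeasureTheory Complex SchwartzMap Matrix
open scoped InnerProductSpace ComplexConjugate Real

namespace Literature.RepresentationTheory.KonnoKonno2007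

open Literature.Analysis.SegalBargmann Literature.RepresentationTheory.HeisenbergGroup
open Literature.NumberTheory.Weil1964

variable {σ : Type*} [Fintype σ] [DecidableEq σ]

local notation "L2R" σ => Lp ℂ 2 (volume : Measure (σ → ℝ))
local notation "SR" σ => SchwartzMap (σ → ℝ) ℂ
local notation "PV" σ => (σ → ℝ) × (σ → ℝ)

/-! ## 1. Levi dilations are implementers -/

section Levi

/-- The phase-space map `m(a, d) : (p, q) ↦ (a p, d q)` of a Levi element. [cite: Folland1989, (4.24)] -/
def leviPhase (a d : (σ → ℝ) ≃ₗ[ℝ] (σ → ℝ)) : PhaseMap σ := fun pq => (a pq.1, d pq.2)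

omit [Fintype σ] [DecidableEq σ] in
/-- unfolding `leviPhase`. [folklore] -/
@[simp] theorem leviPhase_apply (a d : (σ → ℝ) ≃ₗ[ℝ] (σ → ℝ)) (pq : PV σ) :
    leviPhase a d pq = (a pq.1, d pq.2) := rfl

omit [DecidableEq σ] in
/-- **`leviS a` implements `m(a, d)`** whenever `a x · d y = x · y`, with unitary lift `leviL2 a`.
[cite: Folland1989, (4.24)] -/
theorem isImplementerS_leviS {a d : (σ → ℝ) ≃ₗ[ℝ] (σ → ℝ)} (had : ∀ x y : σ → ℝ, a x ⬝ᵥ d y = x ⬝ᵥ y) :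
    IsImplementerS (leviPhase a d) (leviS a) :=
  ⟨fun p q f => leviS_rhoS had p q f, ⟨leviL2 a, liftsTo_leviS a⟩⟩

/-- **The Levi operator in a unitary frame** `μ₀(U)⁻¹ ∘ leviS a ∘ μ₀(U)` implements
`realify U⁻¹ ∘ m(a, d) ∘ realify U`. [cite: Folland1989, (4.24), Prop. (4.39)] -/
theorem isImplementerS_conj_leviS (U : Matrix.unitaryGroup σ ℂ) {a d : (σ → ℝ) ≃ₗ[ℝ] (σ → ℝ)}
    (had : ∀ x y : σ → ℝ, a x ⬝ᵥ d y = x ⬝ᵥ y) :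
    IsImplementerS (realify U⁻¹ ∘ leviPhase a d ∘ realify U)
      ((unitaryOpPi U⁻¹).comp ((leviS a).comp (unitaryOpPi U))) :=
  (isImplementerS_unitaryOpPi_realify U⁻¹).comp ((isImplementerS_leviS had).comp (isImplementerS_unitaryOpPi_realify U))

/-- … and has nonzero (indeed positive) vacuum coefficient `⟪k₀, leviS a h₀⟫`.
[cite: Folland1989, (4.24); §1.7 (1.72); Prop. (4.39)] -/
theorem vacCoeffS_conj_leviS (U : Matrix.unitaryGroup σ ℂ) (a : (σ → ℝ) ≃ₗ[ℝ] (σ → ℝ)) :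
    vacCoeffS ((unitaryOpPi U⁻¹).comp ((leviS a).comp (unitaryOpPi U))) = vacCoeffS (leviS a) := by
  rw [← ContinuousLinearMap.comp_assoc]
  exact vacCoeffS_unitaryOpPi_comp_comp U⁻¹ U (leviS a)

/-- [cite: Folland1989, (4.24); §1.7 (1.72)] -/
theorem vacCoeffS_conj_leviS_ne_zero (U : Matrix.unitaryGroup σ ℂ) (a : (σ → ℝ) ≃ₗ[ℝ] (σ → ℝ)) :
    vacCoeffS ((unitaryOpPi U⁻¹).comp ((leviS a).comp (unitaryOpPi U))) ≠ 0 := by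
  rw [vacCoeffS_conj_leviS]
  exact vacCoeffS_leviS_ne_zero a

/-- **Joint continuity of a Levi family in a frame**: if `t ↦ a_t⁻¹` is operator-norm continuous then
`(t, f) ↦ μ₀(U)⁻¹ (leviS a_t (μ₀(U) f))` is jointly continuous into `𝓢`. [folklore] -/
theorem continuous_conj_leviS_uncurry {P : Type*} [TopologicalSpace P] (U : Matrix.unitaryGroup σ ℂ)
    {L : P → ((σ → ℝ) ≃ₗ[ℝ] (σ → ℝ))}
    (hL : Continuous fun t => (((L t).symm.toContinuousLinearEquiv : (σ → ℝ) ≃L[ℝ] (σ → ℝ)) :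
      (σ → ℝ) →L[ℝ] (σ → ℝ))) :
    Continuous fun x : P × SR σ => ((unitaryOpPi U⁻¹).comp ((leviS (L x.1)).comp (unitaryOpPi U))) x.2 := by
  show Continuous fun x : P × SR σ => unitaryOpPi U⁻¹ (leviS (L x.1) (unitaryOpPi U x.2))
  exact (unitaryOpPi U⁻¹).continuous.comp ((continuous_leviS_uncurry (a := L) hL).comp
    (continuous_fst.prodMk ((unitaryOpPi U).continuous.comp continuous_snd)))

end Levi

/-! ## 2. The constructor -/

section Constructor

variable {G : Type*} [Monoid G] [TopologicalSpace G] {K : Type*} [TopologicalSpace K] {P : Type*} [TopologicalSpace P]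

/-- **`KAK` implementer data from a Levi family in a unitary frame.** Compact part `μ₀ ∘ ιK`; `A`-part
`t ↦ μ₀(U)⁻¹ ∘ leviS (L t) ∘ μ₀(U)` for a continuous family of dilations `L` with contragredients `Ld`; the only
`G`-specific inputs are the phase-map identities `hreal`, `hγA` on the generators and the properness / surjectivity of
the word map. [cite: Folland1989, §4.2 (4.24), Prop. (4.39); Knapp2002, Thm 7.39] -/
theorem kakImplementerData_leviFamily {γ : G → PhaseMap σ} (hγ : ∀ g g' pq, γ (g * g') pq = γ g (γ g' pq))
    {κ : K → G} (ιK : K → Matrix.unitaryGroup σ ℂ) (hιK : Continuous ιK)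
    (hreal : ∀ k pq, γ (κ k) pq = realify (ιK k) pq) {a : P → G} (U : Matrix.unitaryGroup σ ℂ)
    {L Ld : P → ((σ → ℝ) ≃ₗ[ℝ] (σ → ℝ))} (had : ∀ t (x y : σ → ℝ), L t x ⬝ᵥ Ld t y = x ⬝ᵥ y)
    (hL : Continuous fun t => (((L t).symm.toContinuousLinearEquiv : (σ → ℝ) ≃L[ℝ] (σ → ℝ)) :
      (σ → ℝ) →L[ℝ] (σ → ℝ)))
    (hγA : ∀ t pq, γ (a t) pq = realify U⁻¹ (leviPhase (L t) (Ld t) (realify U pq)))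
    (hm : IsProperMap fun p : K × P × K => κ p.1 * a p.2.1 * κ p.2.2)
    (hsurj : Function.Surjective fun p : K × P × K => κ p.1 * a p.2.1 * κ p.2.2) :
    KAKImplementerData γ κ a (fun k => unitaryOpPi (ιK k))
      (fun t => (unitaryOpPi U⁻¹).comp ((leviS (L t)).comp (unitaryOpPi U))) := by
  refine kakImplementerData_unitaryOpPi hγ ιK hιK hreal (fun t => ?_) (fun t => vacCoeffS_conj_leviS_ne_zero U (L t))
    (continuous_conj_leviS_uncurry U hL) hm hsurj
  have h : γ (a t) = realify U⁻¹ ∘ leviPhase (L t) (Ld t) ∘ realify U := funext (hγA t)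
  rw [h]
  exact isImplementerS_conj_leviS U (had t)

/-- In the data of `kakImplementerData_leviFamily` the canonical section takes the value
`‖c_t‖/c_t • (μ₀(U)⁻¹ ∘ leviS (L t) ∘ μ₀(U))`, `c_t = ⟪k₀, leviS (L t) h₀⟫ > 0`-real up to the frame, at `a t` —
recorded at a general `KAK` word (`vacSection_kak`). [cite: Folland1989, (4.24), Prop. (4.39)] -/
theorem vacSection_leviFamily_word {γ : G → PhaseMap σ} (hγ : ∀ g g' pq, γ (g * g') pq = γ g (γ g' pq))
    {κ : K → G} (ιK : K → Matrix.unitaryGroup σ ℂ) (hιK : Continuous ιK)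
    (hreal : ∀ k pq, γ (κ k) pq = realify (ιK k) pq) {a : P → G} (U : Matrix.unitaryGroup σ ℂ)
    {L Ld : P → ((σ → ℝ) ≃ₗ[ℝ] (σ → ℝ))} (had : ∀ t (x y : σ → ℝ), L t x ⬝ᵥ Ld t y = x ⬝ᵥ y)
    (hL : Continuous fun t => (((L t).symm.toContinuousLinearEquiv : (σ → ℝ) ≃L[ℝ] (σ → ℝ)) :
      (σ → ℝ) →L[ℝ] (σ → ℝ)))
    (hγA : ∀ t pq, γ (a t) pq = realify U⁻¹ (leviPhase (L t) (Ld t) (realify U pq)))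
    (hm : IsProperMap fun p : K × P × K => κ p.1 * a p.2.1 * κ p.2.2)
    (hsurj : Function.Surjective fun p : K × P × K => κ p.1 * a p.2.1 * κ p.2.2) (k₁ : K) (t : P) (k₂ : K) :
    vacSection γ (κ k₁ * a t * κ k₂) =
      (((‖vacCoeffS (leviS (L t))‖ : ℂ) / vacCoeffS (leviS (L t))) •
        (((unitaryOpPi (ιK k₁)).comp ((unitaryOpPi U⁻¹).comp ((leviS (L t)).comp (unitaryOpPi U)))).comp
          (unitaryOpPi (ιK k₂)))) := by
  rw [(kakImplementerData_leviFamily hγ ιK hιK hreal U had hL hγA hm hsurj).vacSection_kak k₁ t k₂,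
    vacCoeffS_conj_leviS]

end Constructor

/-! ## 3. The compact case -/

section Compact

variable {G : Type*} [Monoid G] [TopologicalSpace G] {K : Type*} [TopologicalSpace K]

omit [DecidableEq σ] [Monoid G] [TopologicalSpace G] [TopologicalSpace K] in
/-- The identity implements the identity, with unitary lift `1`. [folklore] -/
theorem isImplementerS_id : IsImplementerS (id : PhaseMap σ) (ContinuousLinearMap.id ℂ (SR σ)) :=
  ⟨fun _ _ _ => rfl, ⟨LinearIsometryEquiv.refl ℂ (L2R σ), fun _ => rfl⟩⟩

/-- `vacCoeffS id = ‖k₀‖² ≠ 0`. [cite: Folland1989, §1.7 (1.72)] -/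
theorem vacCoeffS_id_ne_zero : vacCoeffS (ContinuousLinearMap.id ℂ (SR σ)) ≠ 0 := by
  rw [vacCoeffS_of_apply_hermitePi_zero (W := ContinuousLinearMap.id ℂ (SR σ)) rfl]
  exact vacL2_norm_sq_ne_zero

/-- **`KAK` implementer data of a compact `G = κ(K) · κ(K)`**: trivial `A`-part (`P = PUnit`, `a = 1`,
`WA = id`); the word map `(k₁, ⋆, k₂) ↦ κ k₁ · κ k₂` is proper because `K` is compact and `G` Hausdorff.
[cite: Folland1989, Prop. (4.39); Knapp2002, Thm 7.39] -/
theorem kakImplementerData_compact [CompactSpace K] [T2Space G] [ContinuousMul G] {γ : G → PhaseMap σ}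
    (hγ : ∀ g g' pq, γ (g * g') pq = γ g (γ g' pq)) (hone : ∀ pq, γ 1 pq = pq)
    {κ : K → G} (hκ : Continuous κ) (ιK : K → Matrix.unitaryGroup σ ℂ) (hιK : Continuous ιK)
    (hreal : ∀ k pq, γ (κ k) pq = realify (ιK k) pq) (hsurj : ∀ g : G, ∃ k₁ k₂ : K, κ k₁ * κ k₂ = g) :
    KAKImplementerData γ κ (fun _ : PUnit => (1 : G)) (fun k => unitaryOpPi (ιK k))
      (fun _ => ContinuousLinearMap.id ℂ (SR σ)) := by
  refine kakImplementerData_unitaryOpPi hγ ιK hιK hreal (fun _ => ?_) (fun _ => vacCoeffS_id_ne_zero)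
    (continuous_snd : Continuous fun x : PUnit × SR σ => x.2) ?_ ?_
  · have h : γ 1 = id := funext hone
    rw [h]
    exact isImplementerS_id
  · exact Continuous.isProperMap (by fun_prop)
  · intro g
    obtain ⟨k₁, k₂, h⟩ := hsurj g
    exact ⟨(k₁, PUnit.unit, k₂), by simpa only [mul_one] using h⟩

end Compact

/-! ## 4. Consistency: the rank-one junction family IS a Levi family in a frame -/

namespace RealDualPair

open Literature.NumberTheory.Automorphic Literature.NumberTheory.Automorphic.UnitaryGroup

variable {P Q : Type*} (R S : Type*) [Fintype P] [DecidableEq P] [Fintype Q] [DecidableEq Q] [Fintype R]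
  [DecidableEq R] [Fintype S] [DecidableEq S] (p₀ : P) (q₀ : Q)

/-- `hypOp t = μ₀(u)⁻¹ ∘ leviS (δ_{e^t}) ∘ μ₀(u)`, `u = frameU`: the hyperbolic family of
`JunctionHyperbolicFamily` is the Levi family `t ↦ δ_{e^t} = planeDil (e^t)` in the frame `frameU` — so
`JunctionVacuumSection.kakImplementerData_junction` is the case `P = ℝ` of `kakImplementerData_leviFamily`.
[cite: Folland1989, (4.24), Prop. (4.39)] -/
theorem hypOp_eq_conj_leviS (t : ℝ) :
    hypOp R S p₀ q₀ t =
      (unitaryOpPi (frameU R S p₀ q₀)⁻¹).comp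
        ((leviS (planeDil R S p₀ q₀ (Real.exp t) (Real.exp_pos t).ne')).comp (unitaryOpPi (frameU R S p₀ q₀))) :=
  rfl

/-- … over the Levi phase map `realify u⁻¹ ∘ m(δ, δ⁻¹) ∘ realify u = hypPhase t`. [folklore] -/
theorem hypPhase_eq_conj_leviPhase (t : ℝ) (w : PV (DPIdx P Q R S)) :
    hypPhase R S p₀ q₀ t w =
      realify (frameU R S p₀ q₀)⁻¹ (leviPhase (planeDil R S p₀ q₀ (Real.exp t) (Real.exp_pos t).ne')
        (planeDil R S p₀ q₀ (Real.exp t) (Real.exp_pos t).ne').symm (realify (frameU R S p₀ q₀) w)) :=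
  rfl

end RealDualPair

end Literature.RepresentationTheory.KonnoKonno2007

end
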